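import Summits.ABC.IUTFork.BrobergAdmissible
import Summits.ABC.IUTFork.LDHGenuinePerImageUnconditionalDegree
import HarnessLib

/-!
# The fork at [IUTchIII] Corollary 3.12, L-DH level, READING (P): the per-image Corollary AS TYPED at the QUADRATIC Broberg point
# `λ = (8−3√7)²(5−2√7)/(4−3√7)⁴ ∈ ℚ(√7)`, at EVERY prime level `l ≥ 17` — the first (P) instance family at a number-field datum carrier
# (abc-iut cell, branch C, row «C:PERIMAGE-BROBERG»; seat abc-iut-C-cert-2 gen 6)

Record-only PROOF file (D-0012; 0 definitions, 0 `Prop` facts) of the abc-iut cell. TAKES NO SIDE on [IUTchIII] Cor. 3.12 (S. Mochizuki,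
*Inter-universal Teichmüller theory III*, Cor. 3.12 p. 173–174; proof Step (x) p. 181) or on any author; the reading-(P) twin of
abc-iut-C-cert-3's `Conditional/AbcOfSCor312OfBroberg.lean` (p503174; reading (U) at `l = 7, 11`). The Broberg datum carrier is
abc-iut-W-row-2 g3's / abc-iut-w6-d055's `Broberg.point : NFPoint` (`BrobergPoint`, `BrobergAdmissible`: `[ℚ(√7):ℚ] = 2`, `λ ∈ U`,
bad places `𝔭₃, 𝔭₃', 𝔭₄₇` with pole orders `2, 24, 8` and norms `3, 3, 47`, nothing bad over `2`), consumed BY NAME.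

* §1 the arithmetic of the point in the vocabulary of [IUTchIV] Thm. 1.10: sums over the bad places avoiding `S` (`sum_badPlaces_filter_three/_two`,
  peeling `𝔭₃, 𝔭₃', 𝔭₄₇`), the local heights `2/24/8`, the
  log-norms `log 3 / log 3 / log 47`, and for every prime `l ∉ {3, 47}`: **`logQAvoid_pair_of_ne`** `log q^{∤{2,l}}(λ) = 13·log 3 + 4·log 47`,
  **`logCondAvoid_pair_of_ne`** `log 𝔣^{∤{2,l}}(λ) = log 3 + ½·log 47`; at `l = 47`: `13·log 3` and `log 3`; the log-different
  **`half_log_three_le_logDiff`** `log-diff ≥ ½·log 3` from Hermite–Minkowski `|disc ℚ(√7)| > 2` (Mathlib `NumberField.abs_discr_gt_two`) — the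
  exact value `½·log 28` needs `disc ℚ(√7) = 28`, which is NOT in the tree (an honest residual — no fact introduced, C-R100 (b)); `d_mod ≤ [F_tpd:ℚ] = 2`.
* §2 **`cor312PerImageOf_of_nineteen_le`** — for every prime `l ≥ 19`, `l ≠ 47`: `T.Cor312PerImageOf` for EVERY genuine Θ-volume datum
  `T` of `(λ, l)`, by abc-iut-C-cert-1's any-degree unconditional test `cor312PerImageOf_of_le_degree_all` (`LDHGenuinePerImageUnconditionalDegree`),
  the constants of §1 and ONE inequality linear in `l` (slope certificate + the value at `l = 19`, `π > 3`); **`cor312PerImageOf_seventeen`**,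
  **`cor312PerImageOf_fortySeven`** — the two remaining levels by concrete certificates; **`cor312PerImageOf_of_seventeen_le`** — EVERY prime
  `l ≥ 17`, NO hypothesis. Desk margins (seat folder): `l = 17`: 0.87 · `19`: 0.74 · `47`: 14 nats; increasing slope `0.22` nats/level. The levels
  `l ∈ {5, 7, 11, 13}` FAIL the test with the Hermite bound alone and PASS it with the true log-different `½·log 28` (margins 0.65/0.57/1.8/1.4) —
  an HONEST RESIDUAL of this file (C-R100 (b)); not claimed.

READING (neutral; branch-C books): the reading-(P) number binders (γ-K `hNumPOffBad` p462946 / γ-M) conclude `T.Cor312PerImageOf`; at the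
quadratic Broberg point that conclusion is TRUE at every prime `l ≥ 17` (against the generic exponential threshold of
`LDHGenuinePerImageEventually` / abc-iut-c312-d1's `LDHGenuinePerImageEventual` at this point); no record count moves. HONEST SCOPE: OUR typed
per-image inequality ((Ind2) = the cell's full lattice-automorphism typing, Dupuy–Hilado §4.9); nothing about print's (Ind2) or the printed
inequality; nothing asserts that genuine data exist at any `(λ, l)` (admissibility/(P6) at `l = 7, 11` is W-row-2's `BrobergAdmissible`), Cor. 3.12
in general, or abc; proved-as-typed ≠ in print; typed ≠ proved. [cite: Mochizuki2012, IUTchIII Cor. 3.12 p. 173–174, proof Step (x) p. 181; IUTchIV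
Thm. 1.10 p. 22–24, Step (v) p. 27–29, Cor. 2.2 (i) p. 41, (ii) p. 44–46] [cite: MochizukiGenEll2010, Def. 1.5 (iii)(iv) p. 8, Ex. 1.3 (i) p. 5]
[cite: NeukirchANT1999, Ch. III (2.14)] [cite: DupuyHilado2025, §4.9, §4.12] [claim: Mochizuki2012, status: disputed] for every IUT quotation.
-/

noncomputable section

open scoped Classical NumberField

open NumberField IsDedekindDomain IsDedekindDomain.HeightOneSpectrum

namespace Summit.ABC.IUTFork.Broberg

open Sqrt7 Literature.IUT.LogVolume Literature.IUT.LogVolume.Cor22 Literature.NumberTheory.NumberFields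
  Literature.NumberTheory.DiophantineGeometry.GenEll

/-! ## §1. The arithmetic of the point in the vocabulary of [IUTchIV] Thm. 1.10 -/

/-- `2 ∉ v` for the three bad places (cast natural, over the point's field). [folklore] -/
theorem natCast_two_not_mem :
    ((2 : ℕ) : 𝓞 point.F) ∉ (𝔭₃ : HeightOneSpectrum (𝓞 point.F)).asIdeal ∧
      ((2 : ℕ) : 𝓞 point.F) ∉ (𝔭₃' : HeightOneSpectrum (𝓞 point.F)).asIdeal ∧
      ((2 : ℕ) : 𝓞 point.F) ∉ (𝔭₄₇ : HeightOneSpectrum (𝓞 point.F)).asIdeal := by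
  refine ⟨?_, ?_, ?_⟩ <;> rw [Nat.cast_ofNat]
  · exact two_not_mem.1
  · exact two_not_mem.2.1
  · exact two_not_mem.2.2

/-- A prime `l ∉ {3, 47}` lies in none of the three bad places. [folklore] -/
theorem natCast_not_mem_of_ne {l : ℕ} (hl : l.Prime) (h3 : l ≠ 3) (h47 : l ≠ 47) :
    ((l : ℕ) : 𝓞 point.F) ∉ (𝔭₃ : HeightOneSpectrum (𝓞 point.F)).asIdeal ∧
      ((l : ℕ) : 𝓞 point.F) ∉ (𝔭₃' : HeightOneSpectrum (𝓞 point.F)).asIdeal ∧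
      ((l : ℕ) : 𝓞 point.F) ∉ (𝔭₄₇ : HeightOneSpectrum (𝓞 point.F)).asIdeal := by
  have hc3 : Nat.Coprime l 3 := (Nat.coprime_primes hl (by norm_num)).2 h3
  have hc47 : Nat.Coprime l 47 := (Nat.coprime_primes hl (by norm_num)).2 h47
  exact ⟨natCast_not_mem_of_coprime 𝔭₃ natCast_three_mem_𝔭₃ hc3,
    natCast_not_mem_of_coprime 𝔭₃' (by exact_mod_cast three_mem_𝔭₃') hc3,
    natCast_not_mem_of_coprime 𝔭₄₇ natCast_fortySeven_mem_𝔭₄₇ hc47⟩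

/-- **Summing over the bad places avoiding `S`, when all three avoid `S`**: the sum is `f 𝔭₃ + f 𝔭₃' + f 𝔭₄₇` (peeling the three members;
nothing else is bad, `mem_badPlaces_iff`). [cite: Mochizuki2012, IUTchIV Cor. 2.2 (i) p.41] [claim: Mochizuki2012, status: disputed] -/
theorem sum_badPlaces_filter_three {S : Finset ℕ}
    (hS : ∀ p ∈ S, ((p : ℕ) : 𝓞 point.F) ∉ (𝔭₃ : HeightOneSpectrum (𝓞 point.F)).asIdeal ∧
      ((p : ℕ) : 𝓞 point.F) ∉ (𝔭₃' : HeightOneSpectrum (𝓞 point.F)).asIdeal ∧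
      ((p : ℕ) : 𝓞 point.F) ∉ (𝔭₄₇ : HeightOneSpectrum (𝓞 point.F)).asIdeal)
    (f : HeightOneSpectrum (𝓞 point.F) → ℝ) :
    ∑ v ∈ (badPlaces point).filter (fun v => ∀ p ∈ S, ((p : ℕ) : 𝓞 point.F) ∉ v.asIdeal), f v = f 𝔭₃ + f 𝔭₃' + f 𝔭₄₇ := by
  set A := (badPlaces point).filter (fun v => ∀ p ∈ S, ((p : ℕ) : 𝓞 point.F) ∉ v.asIdeal) with hA
  have m3 : (𝔭₃ : HeightOneSpectrum (𝓞 point.F)) ∈ A := Finset.mem_filter.2 ⟨mem_badPlaces.1, fun p hp => (hS p hp).1⟩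
  have m3' : (𝔭₃' : HeightOneSpectrum (𝓞 point.F)) ∈ A.erase 𝔭₃ :=
    Finset.mem_erase.2 ⟨fun h => 𝔭₃_ne_𝔭₃' h.symm, Finset.mem_filter.2 ⟨mem_badPlaces.2.1, fun p hp => (hS p hp).2.1⟩⟩
  have m47 : (𝔭₄₇ : HeightOneSpectrum (𝓞 point.F)) ∈ (A.erase 𝔭₃).erase 𝔭₃' :=
    Finset.mem_erase.2 ⟨𝔭₄₇_ne.2.1, Finset.mem_erase.2 ⟨𝔭₄₇_ne.1,
      Finset.mem_filter.2 ⟨mem_badPlaces.2.2, fun p hp => (hS p hp).2.2⟩⟩⟩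
  have hempty : ((A.erase 𝔭₃).erase 𝔭₃').erase 𝔭₄₇ = ∅ := by
    refine Finset.eq_empty_of_forall_notMem fun v hv => ?_
    simp only [Finset.mem_erase] at hv
    obtain ⟨h47, h3', h3, hvA⟩ := hv
    rcases (mem_badPlaces_iff v).1 (Finset.mem_filter.1 hvA).1 with h | h | h
    · exact h3 h
    · exact h3' h
    · exact h47 h
  rw [← Finset.add_sum_erase A f m3, ← Finset.add_sum_erase _ f m3', ← Finset.add_sum_erase _ f m47, hempty,
    Finset.sum_empty]
  ring

/-- **Summing over the bad places avoiding `S`, when `S` meets `𝔭₄₇` but not `𝔭₃, 𝔭₃'`**: the sum is `f 𝔭₃ + f 𝔭₃'`.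
[cite: Mochizuki2012, IUTchIV Cor. 2.2 (i) p.41] [claim: Mochizuki2012, status: disputed] -/
theorem sum_badPlaces_filter_two {S : Finset ℕ}
    (hS : ∀ p ∈ S, ((p : ℕ) : 𝓞 point.F) ∉ (𝔭₃ : HeightOneSpectrum (𝓞 point.F)).asIdeal ∧
      ((p : ℕ) : 𝓞 point.F) ∉ (𝔭₃' : HeightOneSpectrum (𝓞 point.F)).asIdeal)
    (h47 : ∃ p ∈ S, ((p : ℕ) : 𝓞 point.F) ∈ (𝔭₄₇ : HeightOneSpectrum (𝓞 point.F)).asIdeal)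
    (f : HeightOneSpectrum (𝓞 point.F) → ℝ) :
    ∑ v ∈ (badPlaces point).filter (fun v => ∀ p ∈ S, ((p : ℕ) : 𝓞 point.F) ∉ v.asIdeal), f v = f 𝔭₃ + f 𝔭₃' := by
  set A := (badPlaces point).filter (fun v => ∀ p ∈ S, ((p : ℕ) : 𝓞 point.F) ∉ v.asIdeal) with hA
  have m3 : (𝔭₃ : HeightOneSpectrum (𝓞 point.F)) ∈ A := Finset.mem_filter.2 ⟨mem_badPlaces.1, fun p hp => (hS p hp).1⟩
  have m3' : (𝔭₃' : HeightOneSpectrum (𝓞 point.F)) ∈ A.erase 𝔭₃ :=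
    Finset.mem_erase.2 ⟨fun h => 𝔭₃_ne_𝔭₃' h.symm, Finset.mem_filter.2 ⟨mem_badPlaces.2.1, fun p hp => (hS p hp).2⟩⟩
  have hempty : (A.erase 𝔭₃).erase 𝔭₃' = ∅ := by
    refine Finset.eq_empty_of_forall_notMem fun v hv => ?_
    simp only [Finset.mem_erase] at hv
    obtain ⟨h3', h3, hvA⟩ := hv
    obtain ⟨hvB, hvS⟩ := Finset.mem_filter.1 hvA
    rcases (mem_badPlaces_iff v).1 hvB with h | h | h
    · exact h3 h
    · exact h3' h
    · obtain ⟨p, hp, hpm⟩ := h47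
      exact hvS p hp (h ▸ hpm)
  rw [← Finset.add_sum_erase A f m3, ← Finset.add_sum_erase _ f m3', hempty, Finset.sum_empty]
  ring

/-- The local heights `h_v = −ord_v j(λ)`: `2, 24, 8` at `𝔭₃, 𝔭₃', 𝔭₄₇`. [cite: Mochizuki2012, IUTchIV p. 44] [claim: Mochizuki2012, status: disputed] -/
theorem localHeight_eq :
    localHeight point 𝔭₃ = 2 ∧ localHeight point 𝔭₃' = 24 ∧ localHeight point 𝔭₄₇ = 8 := by
  refine ⟨?_, ?_, ?_⟩
  · show ((-(ord K 𝔭₃ (jInv lam))).toNat : ℝ) = 2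
    rw [ord_jInv_𝔭₃]; rfl
  · show ((-(ord K 𝔭₃' (jInv lam))).toNat : ℝ) = 24
    rw [ord_jInv_𝔭₃']; rfl
  · show ((-(ord K 𝔭₄₇ (jInv lam))).toNat : ℝ) = 8
    rw [ord_jInv_𝔭₄₇]; rfl

/-- The log-norm at `𝔭₃` (stated over the point's own instances): `log 3`. [folklore] -/
theorem logNorm_𝔭₃ (v : HeightOneSpectrum (𝓞 point.F)) (hv : v = 𝔭₃) : logNorm point.F v = Real.log 3 := by
  subst hv
  show Real.log (Ideal.absNorm (Ideal.span ({ϖ₃} : Set (𝓞 K))) : ℝ) = _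
  rw [absNorm_span_ϖ₃]; norm_num

/-- The log-norm at `𝔭₃'`: `log 3`. [folklore] -/
theorem logNorm_𝔭₃' (v : HeightOneSpectrum (𝓞 point.F)) (hv : v = 𝔭₃') : logNorm point.F v = Real.log 3 := by
  subst hv
  show Real.log (Ideal.absNorm (Ideal.span ({ϖ₃'} : Set (𝓞 K))) : ℝ) = _
  rw [absNorm_span_ϖ₃']; norm_num

/-- The log-norm at `𝔭₄₇`: `log 47`. [folklore] -/
theorem logNorm_𝔭₄₇ (v : HeightOneSpectrum (𝓞 point.F)) (hv : v = 𝔭₄₇) : logNorm point.F v = Real.log 47 := by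
  subst hv
  show Real.log (Ideal.absNorm (Ideal.span ({ϖ₄₇} : Set (𝓞 K))) : ℝ) = _
  rw [absNorm_span_ϖ₄₇]; norm_num

/-- The summand of `logCondAvoid_eq_sum` at `𝔭₃`: `log 3`. [folklore] -/
theorem logAbsNorm_𝔭₃ (v : HeightOneSpectrum (𝓞 point.F)) (hv : v = 𝔭₃) :
    Real.log ((Ideal.absNorm v.asIdeal : ℕ) : ℝ) = Real.log 3 := logNorm_𝔭₃ v hv

/-- The summand of `logCondAvoid_eq_sum` at `𝔭₃'`: `log 3`. [folklore] -/
theorem logAbsNorm_𝔭₃' (v : HeightOneSpectrum (𝓞 point.F)) (hv : v = 𝔭₃') :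
    Real.log ((Ideal.absNorm v.asIdeal : ℕ) : ℝ) = Real.log 3 := logNorm_𝔭₃' v hv

/-- The summand of `logCondAvoid_eq_sum` at `𝔭₄₇`: `log 47`. [folklore] -/
theorem logAbsNorm_𝔭₄₇ (v : HeightOneSpectrum (𝓞 point.F)) (hv : v = 𝔭₄₇) :
    Real.log ((Ideal.absNorm v.asIdeal : ℕ) : ℝ) = Real.log 47 := logNorm_𝔭₄₇ v hv

/-- The predicate of the `{2, l}`-filter at the three bad places, `l ∉ {3, 47}`. [folklore] -/
theorem pair_avoids_of_ne {l : ℕ} (hl : l.Prime) (h3 : l ≠ 3) (h47 : l ≠ 47) :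
    ∀ p ∈ ({2, l} : Finset ℕ), ((p : ℕ) : 𝓞 point.F) ∉ (𝔭₃ : HeightOneSpectrum (𝓞 point.F)).asIdeal ∧
      ((p : ℕ) : 𝓞 point.F) ∉ (𝔭₃' : HeightOneSpectrum (𝓞 point.F)).asIdeal ∧
      ((p : ℕ) : 𝓞 point.F) ∉ (𝔭₄₇ : HeightOneSpectrum (𝓞 point.F)).asIdeal := by
  intro p hp
  simp only [Finset.mem_insert, Finset.mem_singleton] at hp
  rcases hp with rfl | rfl
  · exact natCast_two_not_mem
  · exact natCast_not_mem_of_ne hl h3 h47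

/-- **`log q^{∤{2,l}}(λ) = 13·log 3 + 4·log 47`** for every prime `l ∉ {3, 47}` (`[F_tpd:ℚ]·log q = 2·log 3 + 24·log 3 + 8·log 47`).
[cite: Mochizuki2012, IUTchIV Thm 1.10 p.23, Cor. 2.2 (ii) (P5) p.46] [claim: Mochizuki2012, status: disputed] -/
theorem logQAvoid_pair_of_ne {l : ℕ} (hl : l.Prime) (h3 : l ≠ 3) (h47 : l ≠ 47) :
    logQAvoid point {2, l} = 13 * Real.log 3 + 4 * Real.log 47 := by
  have h := degree_mul_logQAvoid point {2, l}
  rw [sum_badPlaces_filter_three (pair_avoids_of_ne hl h3 h47), point_degree, localHeight_eq.1, localHeight_eq.2.1,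
    localHeight_eq.2.2, logNorm_𝔭₃ 𝔭₃ rfl, logNorm_𝔭₃' 𝔭₃' rfl, logNorm_𝔭₄₇ 𝔭₄₇ rfl] at h
  push_cast at h
  linarith

/-- **`log q^{∤{2,47}}(λ) = 13·log 3`**. [cite: Mochizuki2012, IUTchIV Thm 1.10 p.23] [claim: Mochizuki2012, status: disputed] -/
theorem logQAvoid_pair_fortySeven : logQAvoid point {2, 47} = 13 * Real.log 3 := by
  have h := degree_mul_logQAvoid point {2, 47}
  rw [sum_badPlaces_filter_two (fun p hp => ?_) ⟨47, by simp, natCast_fortySeven_mem_𝔭₄₇⟩, point_degree, localHeight_eq.1,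
    localHeight_eq.2.1, logNorm_𝔭₃ 𝔭₃ rfl, logNorm_𝔭₃' 𝔭₃' rfl] at h
  · push_cast at h
    linarith
  · simp only [Finset.mem_insert, Finset.mem_singleton] at hp
    rcases hp with rfl | rfl
    · exact ⟨natCast_two_not_mem.1, natCast_two_not_mem.2.1⟩
    · have hc : Nat.Coprime 47 3 := by norm_num
      exact ⟨natCast_not_mem_of_coprime 𝔭₃ natCast_three_mem_𝔭₃ hc,
        natCast_not_mem_of_coprime 𝔭₃' (by exact_mod_cast three_mem_𝔭₃') hc⟩

/-- **`log 𝔣^{∤{2,l}}(λ) = log 3 + ½·log 47`** for every prime `l ∉ {3, 47}`. [cite: Mochizuki2012, IUTchIV Thm 1.10 p.23]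
[claim: Mochizuki2012, status: disputed] -/
theorem logCondAvoid_pair_of_ne {l : ℕ} (hl : l.Prime) (h3 : l ≠ 3) (h47 : l ≠ 47) :
    logCondAvoid point {2, l} = Real.log 3 + Real.log 47 / 2 := by
  have h := logCondAvoid_eq_sum point {2, l}
  unfold badPlacesAvoid at h
  rw [sum_badPlaces_filter_three (pair_avoids_of_ne hl h3 h47), point_degree, logAbsNorm_𝔭₃ 𝔭₃ rfl, logAbsNorm_𝔭₃' 𝔭₃' rfl,
    logAbsNorm_𝔭₄₇ 𝔭₄₇ rfl] at h
  push_cast at h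
  linarith

/-- **`log 𝔣^{∤{2,47}}(λ) = log 3`**. [cite: Mochizuki2012, IUTchIV Thm 1.10 p.23] [claim: Mochizuki2012, status: disputed] -/
theorem logCondAvoid_pair_fortySeven : logCondAvoid point {2, 47} = Real.log 3 := by
  have h := logCondAvoid_eq_sum point {2, 47}
  unfold badPlacesAvoid at h
  rw [sum_badPlaces_filter_two (fun p hp => ?_) ⟨47, by simp, natCast_fortySeven_mem_𝔭₄₇⟩, point_degree, logAbsNorm_𝔭₃ 𝔭₃ rfl,
    logAbsNorm_𝔭₃' 𝔭₃' rfl] at h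
  · push_cast at h
    linarith
  · simp only [Finset.mem_insert, Finset.mem_singleton] at hp
    rcases hp with rfl | rfl
    · exact ⟨natCast_two_not_mem.1, natCast_two_not_mem.2.1⟩
    · have hc : Nat.Coprime 47 3 := by norm_num
      exact ⟨natCast_not_mem_of_coprime 𝔭₃ natCast_three_mem_𝔭₃ hc,
        natCast_not_mem_of_coprime 𝔭₃' (by exact_mod_cast three_mem_𝔭₃') hc⟩

/-- **`log-diff(λ) ≥ ½·log 3`**: `log-diff = ½·log |disc ℚ(√7)|` (`logDiff_eq_log_discr`) and `|disc| > 2` for a field of degree `2`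
(Hermite–Minkowski, Mathlib `NumberField.abs_discr_gt_two`). The exact value `½·log 28` is not used. [cite: NeukirchANT1999, Ch. III (2.14)] -/
theorem half_log_three_le_logDiff : Real.log 3 / 2 ≤ point.logDiff := by
  rw [NFPoint.logDiff_eq_log_discr, point_degree]
  have h2 : (2 : ℤ) < |NumberField.discr point.F| :=
    NumberField.abs_discr_gt_two (by rw [show Module.finrank ℚ point.F = 2 from finrank_eq_two]; norm_num)
  have h3 : (3 : ℝ) ≤ ((NumberField.discr point.F).natAbs : ℝ) := by
    have : (3 : ℤ) ≤ ((NumberField.discr point.F).natAbs : ℤ) := by rw [Int.natCast_natAbs]; omega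
    exact_mod_cast this
  have hlog := Real.log_le_log (by norm_num) h3
  push_cast
  linarith

/-- `d_mod ≤ [F_tpd:ℚ] = 2` at the point. [cite: Mochizuki2012, IUTchIV Thm 1.10 p.22] [claim: Mochizuki2012, status: disputed] -/
theorem dmod_le_two : (dmod point : ℝ) ≤ 2 := by
  have h := dmod_le_degree point
  rw [point_degree] at h
  exact_mod_cast h

/-! ## §2. The per-image Corollary (reading (P)) at the point -/

/-- The test of `cor312PerImageOf_of_le_degree_all` at the point, reduced to its scalar form: if
`κ_l·Q ≤ ((l+5)/4 − 2)·(½·log 3 + (1 − 1/l)·C + (1 − 2/(l−1))·½·log l) + ((l+5)/4)·log π` with `Q = log q^{∤{2,l}}`, `C = log 𝔣^{∤{2,l}}`,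
then `T.Cor312PerImageOf` at every genuine datum (`d_mod ≤ 2`, `log-diff ≥ ½ log 3`, all factors nonnegative for `l ≥ 5`).
[cite: Mochizuki2012, IUTchIII Cor. 3.12 p. 173–174; IUTchIV Thm. 1.10 Step (v) p. 27–29] [claim: Mochizuki2012, status: disputed] -/
theorem cor312PerImageOf_of_scalar {l : ℕ} (hl : l.Prime) (h5 : 5 ≤ l)
    (h : (((l : ℝ) + 1) / 24 - 1 / (2 * l)) * logQAvoid point {2, l} ≤
      (((l : ℝ) + 5) / 4 - 2) * (Real.log 3 / 2 + (1 - 1 / (l : ℝ)) * logCondAvoid point {2, l}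
          + (1 - 2 / ((l : ℝ) - 1)) * (2⁻¹ * Real.log l))
        + ((l : ℝ) + 5) / 4 * Real.log Real.pi) :
    ∀ T : ThetaVolumeDatumAt point l, T.Cor312PerImageOf := by
  have hl5 : (5 : ℝ) ≤ l := by exact_mod_cast h5
  have hd : (dmod point : ℝ) ≤ ((l : ℝ) + 5) / 4 := le_trans dmod_le_two (by linarith)
  refine cor312PerImageOf_of_le_degree_all point_inU hl h5 hd ?_
  rw [point_degree]
  push_cast
  -- the bracket is nonnegative and increasing in `log-diff`; `(l+5)/4 − d_mod ≥ (l+5)/4 − 2 ≥ 0`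
  have hC0 : 0 ≤ logCondAvoid point {2, l} := logCondAvoid_nonneg point _
  have hlog0 : 0 ≤ Real.log l := Real.log_nonneg (by linarith)
  have h1l : 0 ≤ 1 - 1 / (l : ℝ) := by
    have : 1 / (l : ℝ) ≤ 1 / 5 := one_div_le_one_div_of_le (by norm_num) hl5; linarith
  have h2l : 0 ≤ 1 - 2 / ((l : ℝ) - 1) := by
    rw [sub_nonneg, div_le_one (by linarith)]; linarith
  have hB0 : 0 ≤ Real.log 3 / 2 + (1 - 1 / (l : ℝ)) * logCondAvoid point {2, l} + (1 - 2 / ((l : ℝ) - 1)) * (2⁻¹ * Real.log l) := by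
    have : 0 ≤ Real.log 3 := Real.log_nonneg (by norm_num)
    positivity
  have hX0 : 0 ≤ ((l : ℝ) + 5) / 4 - 2 := by linarith
  have hLD := half_log_three_le_logDiff
  -- replace `log-diff` by its lower bound and `d_mod` by `2`
  have step1 : (((l : ℝ) + 5) / 4 - 2) *
      (Real.log 3 / 2 + (1 - 1 / (l : ℝ)) * logCondAvoid point {2, l} + (1 - 2 / ((l : ℝ) - 1)) * (2⁻¹ * Real.log l)) ≤
      (((l : ℝ) + 5) / 4 - (dmod point : ℝ)) *
      (point.logDiff + (1 - 1 / (l : ℝ)) * logCondAvoid point {2, l} + (1 - 2 / ((l : ℝ) - 1)) * (2⁻¹ * Real.log l)) :=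
    mul_le_mul (by linarith [dmod_le_two]) (by linarith) hB0 (by linarith [dmod_le_two])
  linarith

/-- **READING (P) AT THE BROBERG POINT, EVERY PRIME `l ≥ 19`, `l ≠ 47`**: `T.Cor312PerImageOf` for EVERY genuine Θ-volume datum `T` of
`(λ, l)` — NO hypothesis. With `Q = 13 log 3 + 4 log 47`, `C = log 3 + ½ log 47`: `(1 − 1/l) ≥ 18/19`, `(1 − 2/(l−1)) ≥ 8/9`, `log l ≥ log 19`,
`π > 3`, and the remaining inequality is LINEAR in `l` with positive slope (certificate `47⁴ ≤ 3⁵·19⁸`) and true at `l = 19` (`47⁶ ≤ 3³·19⁷`).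
[cite: Mochizuki2012, IUTchIII Cor. 3.12 p. 173–174; IUTchIV Thm. 1.10 Step (v) p. 27–29] [claim: Mochizuki2012, status: disputed] -/
theorem cor312PerImageOf_of_nineteen_le {l : ℕ} (hl : l.Prime) (h19 : 19 ≤ l) (h47 : l ≠ 47)
    (T : ThetaVolumeDatumAt point l) : T.Cor312PerImageOf := by
  have h3 : l ≠ 3 := by omega
  have hl19 : (19 : ℝ) ≤ l := by exact_mod_cast h19
  refine cor312PerImageOf_of_scalar hl (by omega) ?_ T
  rw [logQAvoid_pair_of_ne hl h3 h47, logCondAvoid_pair_of_ne hl h3 h47]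
  have hp3 : 0 < Real.log 3 := Real.log_pos (by norm_num)
  have hp19 : 0 < Real.log 19 := Real.log_pos (by norm_num)
  have hp47 : 0 < Real.log 47 := Real.log_pos (by norm_num)
  have hpi : Real.log 3 < Real.log Real.pi := Real.log_lt_log (by norm_num) Real.pi_gt_three
  have hQ0 : 0 ≤ 13 * Real.log 3 + 4 * Real.log 47 := by positivity
  -- monotone lower bounds at `l ≥ 19`
  have h1 : 18 / 19 ≤ 1 - 1 / (l : ℝ) := by
    have : 1 / (l : ℝ) ≤ 1 / 19 := one_div_le_one_div_of_le (by norm_num) hl19; linarith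
  have h2 : 8 / 9 ≤ 1 - 2 / ((l : ℝ) - 1) := by
    have : 2 / ((l : ℝ) - 1) ≤ 2 / 18 := div_le_div_of_nonneg_left (by norm_num) (by norm_num) (by linarith); linarith
  have h3' : Real.log 19 ≤ Real.log l := Real.log_le_log (by norm_num) hl19
  have hC0 : 0 ≤ Real.log 3 + Real.log 47 / 2 := by positivity
  have hb1 : 18 / 19 * (Real.log 3 + Real.log 47 / 2) ≤ (1 - 1 / (l : ℝ)) * (Real.log 3 + Real.log 47 / 2) :=
    mul_le_mul_of_nonneg_right h1 hC0
  have hb2 : 8 / 9 * (2⁻¹ * Real.log 19) ≤ (1 - 2 / ((l : ℝ) - 1)) * (2⁻¹ * Real.log l) :=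
    mul_le_mul h2 (by linarith) (by positivity) (by linarith)
  have hX0 : 0 ≤ ((l : ℝ) + 5) / 4 - 2 := by linarith
  -- the `κ_l` side: drop `−1/(2l)`
  have hκ : (((l : ℝ) + 1) / 24 - 1 / (2 * l)) * (13 * Real.log 3 + 4 * Real.log 47) ≤
      ((l : ℝ) + 1) / 24 * (13 * Real.log 3 + 4 * Real.log 47) := by
    have : 0 ≤ 1 / (2 * (l : ℝ)) := by positivity
    nlinarith
  -- lower bound of the bracket by the constant `C19 := ½log3 + (18/19)(log3 + ½log47) + (8/9)(½ log 19)`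
  have hB : (((l : ℝ) + 5) / 4 - 2) * (Real.log 3 / 2 + 18 / 19 * (Real.log 3 + Real.log 47 / 2) + 8 / 9 * (2⁻¹ * Real.log 19)) ≤
      (((l : ℝ) + 5) / 4 - 2) * (Real.log 3 / 2 + (1 - 1 / (l : ℝ)) * (Real.log 3 + Real.log 47 / 2)
        + (1 - 2 / ((l : ℝ) - 1)) * (2⁻¹ * Real.log l)) :=
    mul_le_mul_of_nonneg_left (by linarith) hX0
  -- slope certificate: `s := C19/4 + log3/4 − Q/24 ≥ 0`, i.e. `3^a·47^b ≤ 19^c` shape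
  have hslope : 0 ≤ (Real.log 3 / 2 + 18 / 19 * (Real.log 3 + Real.log 47 / 2) + 8 / 9 * (2⁻¹ * Real.log 19)) / 4
      + Real.log 3 / 4 - (13 * Real.log 3 + 4 * Real.log 47) / 24 := by
    -- 684·(…) : coefficients ×(4·24·19·9/ gcd): log3: 684·(1/8 + 18/76 + 1/4 − 13/24) ; use integer cert
    have hZ : (47 ^ 4 : ℕ) ≤ 3 ^ 5 * 19 ^ 8 := by norm_num
    have hR : ((47 : ℝ) ^ 4) ≤ (3 : ℝ) ^ 5 * (19 : ℝ) ^ 8 := by exact_mod_cast hZ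
    have hlog := Real.log_le_log (by positivity) hR
    rw [Real.log_mul (by positivity) (by positivity), Real.log_pow, Real.log_pow, Real.log_pow] at hlog
    push_cast at hlog
    linarith [hlog, hp3, hp19, hp47]
  -- value at `l = 19`: `(20/24)·Q ≤ 4·C19 + 6·log 3`
  have h19val : (20 : ℝ) / 24 * (13 * Real.log 3 + 4 * Real.log 47) ≤
      4 * (Real.log 3 / 2 + 18 / 19 * (Real.log 3 + Real.log 47 / 2) + 8 / 9 * (2⁻¹ * Real.log 19)) + 6 * Real.log 3 := by
    have hZ : (47 ^ 6 : ℕ) ≤ 3 ^ 3 * 19 ^ 7 := by norm_num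
    have hR : ((47 : ℝ) ^ 6) ≤ (3 : ℝ) ^ 3 * (19 : ℝ) ^ 7 := by exact_mod_cast hZ
    have hlog := Real.log_le_log (by positivity) hR
    rw [Real.log_mul (by positivity) (by positivity), Real.log_pow, Real.log_pow, Real.log_pow] at hlog
    push_cast at hlog
    linarith [hlog, hp3, hp19, hp47]
  have hprod := mul_nonneg (sub_nonneg.2 hl19) hslope
  have hpi' : ((l : ℝ) + 5) / 4 * Real.log 3 ≤ ((l : ℝ) + 5) / 4 * Real.log Real.pi :=
    mul_le_mul_of_nonneg_left hpi.le (by linarith)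
  nlinarith [hκ, hB, hslope, h19val, hprod, hpi', hb1, hb2]

/-- **Level `l = 17`** at the Broberg point: `T.Cor312PerImageOf` at every genuine `T` — NO hypothesis (concrete certificate, `π > 3`,
margin ≈ 0.87 nats). [cite: Mochizuki2012, IUTchIII Cor. 3.12 p. 173–174] [claim: Mochizuki2012, status: disputed] -/
theorem cor312PerImageOf_seventeen (T : ThetaVolumeDatumAt point 17) : T.Cor312PerImageOf := by
  refine cor312PerImageOf_of_scalar (by norm_num) (by norm_num) ?_ T
  rw [logQAvoid_pair_of_ne (by norm_num) (by norm_num) (by norm_num), logCondAvoid_pair_of_ne (by norm_num) (by norm_num) (by norm_num)]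
  have hp3 : 0 < Real.log 3 := Real.log_pos (by norm_num)
  have hp17 : 0 < Real.log 17 := Real.log_pos (by norm_num)
  have hp47 : 0 < Real.log 47 := Real.log_pos (by norm_num)
  have hpi : Real.log 3 < Real.log Real.pi := Real.log_lt_log (by norm_num) Real.pi_gt_three
  have hZ : (47 ^ 5 : ℕ) ≤ 3 ^ 4 * 17 ^ 6 := by norm_num
  have hR : ((47 : ℝ) ^ 5) ≤ (3 : ℝ) ^ 4 * (17 : ℝ) ^ 6 := by exact_mod_cast hZ
  have hlog := Real.log_le_log (by positivity) hR
  rw [Real.log_mul (by positivity) (by positivity), Real.log_pow, Real.log_pow, Real.log_pow] at hlog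
  push_cast at hlog ⊢
  norm_num
  linarith [hlog, hp3, hp17, hp47, hpi]

/-- **Level `l = 47`** (a pole prime of the point): `T.Cor312PerImageOf` at every genuine `T` — NO hypothesis (`log q^{∤{2,47}} = 13 log 3`,
`log 𝔣^{∤{2,47}} = log 3`; margin ≈ 14 nats). [cite: Mochizuki2012, IUTchIII Cor. 3.12 p. 173–174] [claim: Mochizuki2012, status: disputed] -/
theorem cor312PerImageOf_fortySeven (T : ThetaVolumeDatumAt point 47) : T.Cor312PerImageOf := by
  refine cor312PerImageOf_of_scalar (by norm_num) (by norm_num) ?_ T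
  rw [logQAvoid_pair_fortySeven, logCondAvoid_pair_fortySeven]
  have hp3 : 0 < Real.log 3 := Real.log_pos (by norm_num)
  have hp47 : 0 < Real.log 47 := Real.log_pos (by norm_num)
  have hpi : Real.log 3 < Real.log Real.pi := Real.log_lt_log (by norm_num) Real.pi_gt_three
  push_cast
  norm_num
  nlinarith [hp3, hp47, hpi]

/-- **READING (P) AT THE QUADRATIC BROBERG POINT, EVERY PRIME LEVEL `l ≥ 17`** — `T.Cor312PerImageOf` for EVERY genuine Θ-volume
datum `T` of `(λ_Broberg, l)`, NO hypothesis: the first reading-(P) per-image instance family at a number-field datum carrier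
(`l ≥ 19`, `l ≠ 47` uniform; `17`, `47` concrete). [cite: Mochizuki2012, IUTchIII Cor. 3.12 p. 173–174; IUTchIV Thm. 1.10 Step (v) p. 27–29]
[claim: Mochizuki2012, status: disputed] -/
theorem cor312PerImageOf_of_seventeen_le {l : ℕ} (hl : l.Prime) (h17 : 17 ≤ l)
    (T : ThetaVolumeDatumAt point l) : T.Cor312PerImageOf := by
  by_cases h47 : l = 47
  · subst h47; exact cor312PerImageOf_fortySeven T
  by_cases h17' : l = 17
  · subst h17'; exact cor312PerImageOf_seventeen T
  have h18 : l ≠ 18 := by rintro rfl; exact absurd hl (by norm_num)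
  exact cor312PerImageOf_of_nineteen_le hl (by omega) h47 T

end Summit.ABC.IUTFork.Broberg

end
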